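import Summits.SmoothPoincare4.SmoothPoincare4.Theorems.SullivanDualWitnessChargeV15CapModelGlue

/-!
# Cap model for crux `WitnessCharge`, I-b: the cap is Hausdorff and second countable

Sequel to `…V15CapModelGlue.lean` (stub `stub_capModel` of skeleton v15, line `Sketch`, lead c8):
the graph of the gluing map `x ↦ ((z x)⁻¹, w x)` is closed (the gluing region lies compactly inside
the `ε'`-chart-ball because `ρ ≤ ε'/2`, and there `(z x) · t = 1` and `glue x = b` persist in the
limit), so the glued space is Hausdorff (Kosinski VI.1); it is σ-compact (both pieces are), hence
second countable.
-/

noncomputable section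

set_option linter.dupNamespace false

open scoped Manifold ContDiff Topology
open Set Filter Function Literature.Geometry.Symplectic Literature.Topology.FourManifolds
  TopologicalSpace

namespace Summit.SmoothPoincare4.SmoothPoincare4.Theorems.WitnessCharge.PencilIncompleteness

variable {S : HomotopySphere 4} {p : S.carrier} {ε' : ℝ}

section Topology

variable (hε' : 0 < ε')
  (hball : Metric.closedBall (extChartAt (𝓡 4) p p) ε' ⊆ (extChartAt (𝓡 4) p).target)

/-- `min (ε'/2) 1 ≤ ε'/2 < ε'` for `0 < ε'` (the cap radius is at most half the chart radius).
Registered helper of the crux (stub `stub_capModel`, file I-b). -/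
theorem helper_capModel_capRadius_lt :
    ∀ ε' : ℝ, 0 < ε' → min (ε' / 2) 1 ≤ ε' / 2 ∧ ε' / 2 < ε' :=
  fun _ h => ⟨min_le_left _ _, by linarith⟩

/-! ### Hausdorffness: the graph of the gluing map is closed -/

/-- For `x` in the gluing region, `‖e x − e p‖ ≤ ρ ≤ ε'/2`: the gluing region lies compactly
inside the `ε'`-chart-ball. -/
theorem norm_sub_le_of_mem_capGlue_source {x : punctured p} (hx : x ∈ (capGlue hε' hball).source) :
    ‖extChartAt (𝓡 4) p x.1 - extChartAt (𝓡 4) p p‖ ≤ capRadius ε' := by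
  obtain ⟨hb, hlt⟩ := (mem_capGlue_source_iff hε' hball x).1 hx
  have hρ := capRadius_pos hε'
  have h1 : (capRadius ε')⁻¹ < ‖realify (Ycoord p x)‖ := hlt.trans_le (Target.CroftonPencil.norm_fst_le_norm_realify _)
  rw [realify_Ycoord, norm_inversion] at h1
  have hne : extChartAt (𝓡 4) p x.1 - extChartAt (𝓡 4) p p ≠ 0 := sub_ne_zero_of_ball hb
  exact ((inv_lt_inv₀ hρ (norm_pos_iff.2 hne)).1 h1).le

include hball in
/-- The closed collar `{x | x ∈ e.source, ‖e x − e p‖ ≤ r}` of the chart at `p` is closed in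
`Σ ∖ p` for `r ≤ ε'` (it is the trace of the compact set `e.symm (closedBall (e p) r)`). -/
theorem isClosed_collar {r : ℝ} (hr : r ≤ ε') :
    IsClosed {x : punctured p | x.1 ∈ (chartAt (EuclideanSpace ℝ (Fin 4)) p).source ∧
      extChartAt (𝓡 4) p x.1 ∈ Metric.closedBall (extChartAt (𝓡 4) p p) r} := by
  set e := extChartAt (𝓡 4) p
  have hsub : Metric.closedBall (e p) r ⊆ e.target := (Metric.closedBall_subset_closedBall hr).trans hball
  have hK : IsCompact (e.symm '' Metric.closedBall (e p) r) :=
    (isCompact_closedBall _ _).image_of_continuousOn ((continuousOn_extChartAt_symm p).mono hsub)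
  have hKeq : e.symm '' Metric.closedBall (e p) r =
      e.source ∩ e ⁻¹' Metric.closedBall (e p) r :=
    e.symm_image_eq_source_inter_preimage hsub
  have hcl : IsClosed (e.source ∩ e ⁻¹' Metric.closedBall (e p) r) := hKeq ▸ hK.isClosed
  have : {x : punctured p | x.1 ∈ (chartAt (EuclideanSpace ℝ (Fin 4)) p).source ∧
      e x.1 ∈ Metric.closedBall (e p) r} =
      Subtype.val ⁻¹' (e.source ∩ e ⁻¹' Metric.closedBall (e p) r) := by
    ext x
    simp only [mem_setOf_eq, mem_preimage, mem_inter_iff, e, extChartAt_source]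
  rw [this]
  exact hcl.preimage continuous_subtype_val

/-- **The graph of the gluing map is closed** in `(Σ ∖ p) × capDisc ρ`. -/
theorem isClosed_capGlue_graph :
    IsClosed {q : punctured p × capDisc (capRadius ε') |
      q.1 ∈ (capGlue hε' hball).source ∧ capGlue hε' hball q.1 = q.2} := by
  have hρ := capRadius_pos hε'
  set G := {q : punctured p × capDisc (capRadius ε') |
      q.1 ∈ (capGlue hε' hball).source ∧ capGlue hε' hball q.1 = q.2}
  -- the collar of radius `ε'/2`
  set C := {x : punctured p | x.1 ∈ (chartAt (EuclideanSpace ℝ (Fin 4)) p).source ∧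
      extChartAt (𝓡 4) p x.1 ∈ Metric.closedBall (extChartAt (𝓡 4) p p) (ε' / 2)}
  have hC : IsClosed C := isClosed_collar hball (by linarith)
  have hGC : G ⊆ C ×ˢ (univ : Set (capDisc (capRadius ε'))) := by
    rintro ⟨x, b⟩ ⟨hx, -⟩
    refine ⟨⟨((mem_capGlue_source_iff hε' hball x).1 hx).1.1, ?_⟩, mem_univ _⟩
    rw [Metric.mem_closedBall, dist_eq_norm]
    exact (norm_sub_le_of_mem_capGlue_source hε' hball hx).trans capRadius_le_half
  have hCball : ∀ x ∈ C, InPuncturedChartBall p ε' x := by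
    rintro x ⟨hx1, hx2⟩
    refine ⟨hx1, ?_⟩
    rw [Metric.mem_closedBall] at hx2
    rw [Metric.mem_ball]
    linarith
  refine isClosed_of_closure_subset fun q hq => ?_
  -- `q.1` lies in the collar, hence in the chart-ball
  have hq1C : q.1 ∈ C := by
    have : q ∈ C ×ˢ (univ : Set (capDisc (capRadius ε'))) :=
      closure_minimal hGC (hC.prod isClosed_univ) hq
    exact this.1
  have hq1ball : InPuncturedChartBall p ε' q.1 := hCball _ hq1C
  -- the filter `𝓝 q ⊓ 𝓟 G` is nontrivial
  have hne : (𝓝 q ⊓ 𝓟 G).NeBot := mem_closure_iff_clusterPt.1 hq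
  -- `(z x) * t = 1` persists in the limit
  have hY : ContinuousAt (fun q' : punctured p × capDisc (capRadius ε') => Ycoord p q'.1) q :=
    (contMDiffAt_Ycoord hq1ball).continuousAt.comp continuousAt_fst
  have hφ : ContinuousAt (fun q' : punctured p × capDisc (capRadius ε') =>
      (Ycoord p q'.1).1 * ((q'.2 : ℂ × ℂ).1)) q :=
    (continuous_fst.continuousAt.comp hY).mul
      ((continuous_fst.comp (continuous_subtype_val.comp continuous_snd)).continuousAt)
  have hφG : ∀ q' ∈ G, (Ycoord p q'.1).1 * ((q'.2 : ℂ × ℂ).1) = 1 := by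
    rintro ⟨x, b⟩ ⟨hx, hxb⟩
    have hcoe := capGlue_apply_coe hε' hball x hx
    rw [hxb] at hcoe
    have hz : (Ycoord p x).1 ≠ 0 :=
      norm_pos_iff.1 ((inv_pos.2 hρ).trans ((mem_capGlue_source_iff hε' hball x).1 hx).2)
    have hb1 : ((b : ℂ × ℂ)).1 = ((Ycoord p x).1)⁻¹ := by
      have := congrArg Prod.fst hcoe
      simpa using this
    show (Ycoord p x).1 * ((b : ℂ × ℂ)).1 = 1
    rw [hb1, mul_inv_cancel₀ hz]
  have h1 : Filter.Tendsto (fun q' : punctured p × capDisc (capRadius ε') =>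
      (Ycoord p q'.1).1 * ((q'.2 : ℂ × ℂ).1)) (𝓝 q ⊓ 𝓟 G) (𝓝 ((Ycoord p q.1).1 * ((q.2 : ℂ × ℂ).1))) :=
    hφ.tendsto.mono_left inf_le_left
  have h2 : Filter.Tendsto (fun q' : punctured p × capDisc (capRadius ε') =>
      (Ycoord p q'.1).1 * ((q'.2 : ℂ × ℂ).1)) (𝓝 q ⊓ 𝓟 G) (𝓝 1) := by
    refine tendsto_const_nhds.congr' ?_
    exact eventually_inf_principal.2 (Eventually.of_forall fun q' hq' => (hφG q' hq').symm)
  have hprod : (Ycoord p q.1).1 * ((q.2 : ℂ × ℂ).1) = 1 := tendsto_nhds_unique h1 h2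
  have ht : ((q.2 : ℂ × ℂ).1) ≠ 0 := fun h => by simp [h] at hprod
  have hzq : (Ycoord p q.1).1 = ((q.2 : ℂ × ℂ).1)⁻¹ := eq_inv_of_mul_eq_one_left hprod
  -- hence `q.1` is in the gluing region
  have hq1 : q.1 ∈ (capGlue hε' hball).source := by
    rw [mem_capGlue_source_iff]
    refine ⟨hq1ball, ?_⟩
    rw [hzq, norm_inv]
    exact (inv_lt_inv₀ hρ (norm_pos_iff.2 ht)).2 q.2.2
  -- and `glue q.1 = q.2` by continuity of `glue` at `q.1`
  have hg : ContinuousAt (fun q' : punctured p × capDisc (capRadius ε') =>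
      ((capGlue hε' hball q'.1 : capDisc (capRadius ε')) : ℂ × ℂ)) q :=
    (continuous_subtype_val.continuousAt.comp
      ((capGlue hε' hball).continuousAt hq1)).comp continuousAt_fst
  have h3 : Filter.Tendsto (fun q' : punctured p × capDisc (capRadius ε') =>
      ((capGlue hε' hball q'.1 : capDisc (capRadius ε')) : ℂ × ℂ) - (q'.2 : ℂ × ℂ))
      (𝓝 q ⊓ 𝓟 G) (𝓝 (((capGlue hε' hball q.1 : capDisc (capRadius ε')) : ℂ × ℂ) - (q.2 : ℂ × ℂ))) :=
    (hg.sub (continuous_subtype_val.comp continuous_snd).continuousAt).tendsto.mono_left inf_le_left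
  have h4 : Filter.Tendsto (fun q' : punctured p × capDisc (capRadius ε') =>
      ((capGlue hε' hball q'.1 : capDisc (capRadius ε')) : ℂ × ℂ) - (q'.2 : ℂ × ℂ))
      (𝓝 q ⊓ 𝓟 G) (𝓝 0) := by
    refine tendsto_const_nhds.congr' ?_
    refine eventually_inf_principal.2 (Eventually.of_forall fun q' hq' => ?_)
    show (0 : ℂ × ℂ) = ((capGlue hε' hball q'.1 : capDisc (capRadius ε')) : ℂ × ℂ) - (q'.2 : ℂ × ℂ)
    rw [hq'.2, sub_self]
  have h5 := tendsto_nhds_unique h3 h4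
  exact ⟨hq1, Subtype.ext (sub_eq_zero.1 h5)⟩

/-- **The cap model is Hausdorff.** -/
theorem t2Space_capGlued : T2Space (capGlueData hε' hball).Glued :=
  (capGlueData hε' hball).t2Space_of_isClosed_graph (isClosed_capGlue_graph hε' hball)

/-! ### Second countability -/

/-- `Σ ∖ p` is σ-compact (a second countable manifold). -/
theorem sigmaCompactSpace_punctured : SigmaCompactSpace (punctured p) := by
  haveI : LocallyCompactSpace (punctured p) :=
    Manifold.locallyCompact_of_finiteDimensional (I := 𝓡 4) (M := punctured p)
  exact sigmaCompactSpace_of_locallyCompact_secondCountable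

/-- The cap disc is σ-compact. -/
theorem sigmaCompactSpace_capDisc : SigmaCompactSpace (capDisc (capRadius ε')) := by
  haveI : LocallyCompactSpace (capDisc (capRadius ε')) :=
    (capDisc (capRadius ε')).2.isOpenEmbedding_subtypeVal.locallyCompactSpace
  exact sigmaCompactSpace_of_locallyCompact_secondCountable

/-- The cap model is σ-compact. -/
theorem sigmaCompactSpace_capGlued : SigmaCompactSpace (capGlueData hε' hball).Glued := by
  haveI := sigmaCompactSpace_punctured (p := p)
  haveI := sigmaCompactSpace_capDisc (ε' := ε')
  set d := capGlueData hε' hball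
  refine ⟨⟨fun n => d.inl '' compactCovering (punctured p) n ∪ d.inr '' compactCovering _ n,
    fun n => ((isCompact_compactCovering _ n).image d.continuous_inl).union
      ((isCompact_compactCovering _ n).image d.continuous_inr), ?_⟩⟩
  rw [iUnion_union_distrib, ← image_iUnion, ← image_iUnion, iUnion_compactCovering,
    iUnion_compactCovering, image_univ, image_univ]
  exact d.range_inl_union_range_inr

/-- **The cap model is second countable.** -/
theorem secondCountableTopology_capGlued : SecondCountableTopology (capGlueData hε' hball).Glued := by
  haveI := sigmaCompactSpace_capGlued hε' hball
  exact (capGlueData hε' hball).secondCountableTopology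

end Topology

end Summit.SmoothPoincare4.SmoothPoincare4.Theorems.WitnessCharge.PencilIncompleteness
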